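import Summits.AtomisticToContinuum.Crystallization.Theses.PalmUnimodularRigidity
import Summits.AtomisticToContinuum.Crystallization.Theorems.ShellsToBarlowChart.Negative.ScaleWindow

/-!
# Line `holonomy-growth-dichotomy` — skeleton for crux `ShellsToBarlowChart`
(stmt-AtomisticToContinuum-9227, route `PalmUnimodularRigidity`, sub-problem `Crystallization`)

Crux (by name, concluded below by `ShellsToBarlowChart_of`):
`Summit.AtomisticToContinuum.Crystallization.Theses.PalmUnimodularRigidity.ShellsToBarlowChart` —
a non-empty `S ⊆ ℝ³` all of whose points have a `1 %`-good FCC/HCP first shell at a scale in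
`[9/10, 1]` is bond-isomorphic to an ideal Barlow stacking `barlowStacking 1 √(2/3) s`.

## The line (idea card `Ideas/holonomy-growth-dichotomy.md`, triage r1: pass ×3)

QUOTIENT AND COUNT.  A star-bijective cover `π : B_s → S` of the window graph of `S` by the contact
graph of an ideal stacking `B_s = model s` exists (front end, `stub_barlowCover`); its fibres are the
orbits of a group `H` of isometries of `ℝ³` preserving `B_s` and acting freely on it — the HOLONOMY /
deck group of the flat chart transport (`stub_deckGroup`: `π₁` of the flag complex of `B_s` is
trivial, deck transformations are realised by isometries because stars are rigid).  Then `H = 1`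
by a DICHOTOMY on any `h ∈ H ∖ {1}`:
* `h` of finite order ⇒ `⟨h⟩` fixes a point of `ℝ³` ⇒ (covering radius of `B_s` is `< 1`) some
  site moves by Euclidean distance `< 2`, i.e. by graph distance `≤ 2`
  (`stub_shortMove_of_finiteOrder`) — impossible, fibres of a star-bijective cover are `3`-sparse
  (proved in the glue from star-injectivity);
* `h` of infinite order ⇒ (linear parts of stacking-preserving isometries permute the `≤ 18` bond
  vectors, a finite spanning set) some power `h^m` is a translation by `v ≠ 0`
  (`stub_translation_of_infiniteOrder`) ⇒ `π` is constant on forward `ℤv`-classes, of which the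
  graph `n`-ball of `B_s` meets only `≤ K n²` (`stub_quadraticGrowth_modTranslation`) ⇒ the window
  graph of `S` has at most quadratic growth — against CUBIC growth forced by the hard core `0.89`,
  the covering radius `≤ 3/4` and the Euclid-to-graph distortion of an every-point-good set in `ℝ³`
  (`stub_cubicGrowth`).
So `π` is injective, hence the bond-isomorphism `Φ` of the crux (glue, proved: `ShellsToBarlowChart_of`,
whose hypotheses are the six named statements `Registered.stub_*`, each proved definitionally by its
registered `theorem stub_*` — § Consistency).

## Registered stubs (6; sorries live ONLY here)

| stub | size | side | content |
|---|---|---|---|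
| `stub_barlowCover` | XL (hardest) | S + model | star-bijective Barlow cover of the window graph (= card develop-the-model's `ModelCovering`, link-recognition's development) |
| `stub_deckGroup` | L | covering theory | fibres = orbits of a free group of stacking isometries (universal-cover step, named as the triage asked) |
| `stub_cubicGrowth` | M | S only | `c·n³ ≤ #ball_n` of the window graph |
| `stub_shortMove_of_finiteOrder` | M | model only | finite-order stacking isometry moves a site by graph distance `≤ 2` |
| `stub_translation_of_infiniteOrder` | M | model only | infinite-order stacking isometry has a power that is a non-zero translation |
| `stub_quadraticGrowth_modTranslation` | M | model only | graph `n`-ball of `B_s` meets `≤ K n²` forward `ℤv`-classes |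

## Disproof used (`Cruxes/ShellsToBarlowChart/Disproof.lean`, cycle 2b; landed `Negative/Calibration` +
`Negative/ScaleWindow` imported above — `Negative/Tolerance` (p75706) is in the tree but not yet built on
the farm at check time, read from the work file instead)

* `shellsToBarlowChart_false_without_nonempty` — honoured: `S.Nonempty` is a hypothesis of
  `stub_barlowCover` (a cover must hit `S`; `B_s ≠ ∅`) and of `stub_cubicGrowth`, and the glue counts
  the ball around `π p₀`.
* `…_false_without_scaleUpper/Lower`, `…_false_tol_eighth` — honoured: the window `[9/10, 1]` and the
  tolerance `a/100` are carried VERBATIM in `EveryPointGood` (hypothesis of stubs 1–3); they are spent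
  inside `stub_barlowCover` exactly where the disprover locates them (bond window = shell adjacency,
  `margins`) and in `stub_cubicGrowth` (hard core / covering radius, `hardCore_bounds`).
* `…_false_subshell` — honoured: `↑T = shell` (exclusivity) is verbatim in `EveryPointGood`; the
  interpenetrating witness `B ∪ (B + (0,0,1/2))` has no hard core `0.89`, which `stub_cubicGrowth` and
  the star-surjectivity in `stub_barlowCover` consume.
* `not_shellsToFccChart` — respected: the Hägg word `s` is an OUTPUT of `stub_barlowCover` (read off
  the development), never fixed.
* refuted METRIC strengthenings (§(c): log-spiral drift, two NN distances) — respected: no stub compares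
  frames or distances of far-apart shells; the conclusion and every stub are combinatorial / counting.
* No stub is an instance of a landed `Theorems/ShellsToBarlowChart/Negative/*` lemma: stubs 1–3 take
  the crux hypothesis unweakened, stubs 4–6 speak about ideal stackings only.
-/

noncomputable section

namespace Summit.AtomisticToContinuum.Crystallization.Cruxes.ShellsToBarlowChart.HolonomyGrowthDichotomy

open Literature.Geometry.DiscreteGeometry Literature.MathematicalPhysics.StatisticalMechanics

/-- Euclidean `3`-space. -/
local notation "E3" => EuclideanSpace ℝ (Fin 3)

/-! ## Vocabulary of the line -/

/-- The MODEL: the ideal Barlow stacking with unit contacts and Hägg word `s`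
(`barlowStacking 1 √(2/3) s`, the stacking named in the crux's conclusion). -/
def model (s : ℤ → ℤ) : Set E3 := barlowStacking 1 (Real.sqrt (2 / 3)) s

/-- The per-point hypothesis of the crux, VERBATIM (scale window `[9/10, 1]`, tolerance `a/100`,
shell radius `5a/4`, exclusivity `↑T = shell`). -/
def EveryPointGood (S : Set E3) : Prop :=
  ∀ x ∈ S, (∃ a : ℝ, 9 / 10 ≤ a ∧ a ≤ 1 ∧ ∃ T : Finset E3,
    (↑T : Set E3) = (fun y : E3 => y - x) '' {y : E3 | y ∈ S ∧ y ≠ x ∧ dist y x ≤ 5 / 4 * a} ∧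
    (ShellCloseTo (a / 100) T (Finset.image (fun v : E3 => a • v) fccKissingPattern) ∨
      ShellCloseTo (a / 100) T (Finset.image (fun v : E3 => a • v) hcpKissingPattern)))

/-- The WINDOW (bond) relation of the crux's conclusion: distance in `(0, 28/25]`. -/
def W (x y : E3) : Prop := 0 < dist x y ∧ dist x y ≤ 28 / 25

/-- The CONTACT relation of the model: distance exactly `1`. -/
def C (p q : E3) : Prop := dist p q = 1

/-- GRAPH BALLS: the points of `A` reachable from `x` in at most `n` steps of the relation `R`
through points of `A` (radius `0`: `{x}`). Used with `R = W, A = S` (window graph of `S`) and with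
`R = C, A = model s` (contact graph of the model). -/
def ball (R : E3 → E3 → Prop) (A : Set E3) (x : E3) : ℕ → Set E3
  | 0 => {x}
  | n + 1 => ball R A x n ∪ {z : E3 | z ∈ A ∧ ∃ y ∈ ball R A x n, R y z}

/-- `π` is a STAR-BIJECTIVE BARLOW COVER of `S` by the model with word `s`: it maps the model onto
`S`, and for every site `p` it maps the twelve contacts of `p` bijectively onto the window-neighbours
of `π p` in `S` (the shape of card develop-the-model's `ModelCovering`). Every quotient `B_s/Γ`
embedded with good shells admits one; injectivity is NOT asked. -/
def IsBarlowCover (S : Set E3) (s : ℤ → ℤ) (π : E3 → E3) : Prop :=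
  Set.MapsTo π (model s) S ∧ Set.SurjOn π (model s) S ∧
    ∀ p ∈ model s, Set.BijOn π {q : E3 | q ∈ model s ∧ dist p q = 1} {y : E3 | y ∈ S ∧ W (π p) y}

/-- `H` is a DECK (holonomy) GROUP of the cover `π`: a subgroup of the isometry group of `ℝ³` whose
elements preserve the model and act FREELY on its sites, and whose orbits on the model are exactly
the fibres of `π` ("`S ≅ B_s / H`"). -/
def IsDeckGroup (s : ℤ → ℤ) (π : E3 → E3) (H : Subgroup (E3 ≃ᵢ E3)) : Prop :=
  (∀ g ∈ H, ∀ p ∈ model s, g p ∈ model s) ∧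
  (∀ g ∈ H, ∀ p ∈ model s, g p = p → g = 1) ∧
  (∀ p ∈ model s, ∀ q ∈ model s, (π p = π q ↔ ∃ g ∈ H, g p = q))

/-! ## The six stub STATEMENTS as named propositions, keyed by the registered stub names

The skeleton audit admits a hypothesis of the composition only if its head constant is a registered
obligation or is NAMED LIKE a declared stub (the stub attribute itself is gate-reserved); so each stub
statement is `def Registered.stub_… : Prop`, the registered `theorem stub_… : <the same statement,
expanded> := by sorry` proves it definitionally (§ Consistency), and `ShellsToBarlowChart_of` takes the
six `Registered.stub_…` as hypotheses. -/

namespace Registered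

/-- Statement of stub 1 (`stub_barlowCover`): star-bijective Barlow cover of every non-empty
every-point-good set. -/
def stub_barlowCover : Prop :=
  ∀ S : Set E3, S.Nonempty → EveryPointGood S →
    ∃ s : ℤ → ℤ, IsHaggSeq s ∧ ∃ π : E3 → E3, IsBarlowCover S s π

/-- Statement of stub 2 (`stub_deckGroup`): fibres of a star-bijective Barlow cover are the orbits of a
free group of stacking isometries. -/
def stub_deckGroup : Prop :=
  ∀ S : Set E3, EveryPointGood S → ∀ s : ℤ → ℤ, IsHaggSeq s → ∀ π : E3 → E3,
    IsBarlowCover S s π → ∃ H : Subgroup (E3 ≃ᵢ E3), IsDeckGroup s π H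

/-- Statement of stub 3 (`stub_cubicGrowth`): cubic growth of the window graph. -/
def stub_cubicGrowth : Prop :=
  ∀ S : Set E3, S.Nonempty → EveryPointGood S →
    ∃ c : ℝ, 0 < c ∧ ∀ x ∈ S, ∀ n : ℕ, 1 ≤ n → c * (n : ℝ) ^ 3 ≤ ((ball W S x n).ncard : ℝ)

/-- Statement of stub 4 (`stub_shortMove_of_finiteOrder`): a finite-order stacking isometry moves a
site by graph distance `≤ 2`. -/
def stub_shortMove_of_finiteOrder : Prop :=
  ∀ s : ℤ → ℤ, IsHaggSeq s → ∀ g : E3 ≃ᵢ E3, (∀ p ∈ model s, g p ∈ model s) →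
    ∀ n : ℕ, 1 ≤ n → g ^ n = 1 →
      ∃ p ∈ model s, g p = p ∨ dist p (g p) = 1 ∨
        ∃ r ∈ model s, dist p r = 1 ∧ dist r (g p) = 1

/-- Statement of stub 5 (`stub_translation_of_infiniteOrder`): an infinite-order stacking isometry has
a power which is a non-zero translation. -/
def stub_translation_of_infiniteOrder : Prop :=
  ∀ s : ℤ → ℤ, IsHaggSeq s → ∀ g : E3 ≃ᵢ E3, (∀ p ∈ model s, g p ∈ model s) →
    (∀ n : ℕ, 1 ≤ n → g ^ n ≠ 1) →
      ∃ m : ℕ, 1 ≤ m ∧ ∃ v : E3, v ≠ 0 ∧ ∀ x : E3, (g ^ m) x = x + v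

/-- Statement of stub 6 (`stub_quadraticGrowth_modTranslation`): the contact `n`-ball meets `≤ K n²`
forward `ℤv`-classes. -/
def stub_quadraticGrowth_modTranslation : Prop :=
  ∀ s : ℤ → ℤ, IsHaggSeq s → ∀ v : E3, v ≠ 0 → (∀ p ∈ model s, p + v ∈ model s) →
    ∃ K : ℝ, ∀ p₀ ∈ model s, ∀ n : ℕ, 1 ≤ n → ∃ F : Finset E3,
      (F.card : ℝ) ≤ K * (n : ℝ) ^ 2 ∧
        ∀ q ∈ ball C (model s) p₀ n, ∃ k : ℕ, q + (k : ℝ) • v ∈ F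

end Registered

/-! ## The registered stubs (the same statements, expanded; `sorry` lives ONLY here) -/

/-- **Stub 1 (front end; XL — the hardest stub).** Every non-empty every-point-good `S` is covered
star-bijectively by the contact graph of SOME ideal Barlow stacking: there are a Hägg word `s` and
`π : model s → S`, onto, carrying the twelve contacts of each site bijectively onto the window
neighbours of its image.

Why plausible: this is the crux minus injectivity — it holds verbatim for every embedded quotient
`B_s/Γ` (coiled sheets, wrap-arounds), so it carries NO global content; it is Hales's layer
propagation (tree `LayerPropagation` / `LayerStackings`, exact case `HalesDSP_layerPackings_holds`)
re-run with `1 %` tolerance either on the MODEL side (card develop-the-model: path lifting on `ℤ²`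
layers, local lemmas P1 = equator propagation and OCCUPANCY = caps are level, margins `≥ 0.28a`
vs `0.06a`; Disproof `equatorPropagation_margin`, `capClash_lt_hardCore`) or by developing the
universal cover of the clique complex of the window graph (this card), or via link-recognition's
certified radius-2 amalgam classification.  All local combinatorics is EXACT at `1 %` (Disproof
`margins`: window graph = shell graph, links = cuboctahedron / anticuboctahedron, 4 common
neighbours per bond).  Uses `S.Nonempty` (`shellsToBarlowChart_false_without_nonempty`) and the
whole verbatim hypothesis (`…_false_without_scaleUpper/Lower`, `…_false_subshell`).
Leans on: `KissingPatterns.{ShellCloseTo, EtaMatched, card_eq_twelve_of_shellCloseTo}`,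
`KissingRigidity.{fccTab, hcpTab, isArrangedIn_fcc_of_contactGraph_iso}`,
`LayerPropagation.{fcc_range_common_unique, hcp_range_common_two, kissingShell_add_eq_layerShell_of_hcp}`,
`LayerStackings.{exists_next_layer, holeTriple_type_eq_of_adjacent}`, `BarlowRings` distance gap,
Disproof/Negative `margins`, `hardCore_bounds`. -/
theorem stub_barlowCover :
    ∀ S : Set E3, S.Nonempty → EveryPointGood S →
      ∃ s : ℤ → ℤ, IsHaggSeq s ∧ ∃ π : E3 → E3, IsBarlowCover S s π := by
  sorry

/-- **Stub 2 (the universal-cover / holonomy step; L).** The fibres of ANY star-bijective Barlow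
cover of the window graph of an every-point-good `S` are the orbits of a subgroup `H` of isometries
of `ℝ³` preserving the model and acting freely on its sites.

Why plausible (classical covering theory, Bridson–Haefliger I.8 App., Lyndon–Schupp III): take
`H := {g : E3 ≃ᵢ E3 | g '' model s = model s ∧ π ∘ g = π on model s}`.  (i) `π` is a covering of
graphs with unique walk lifting (star-bijectivity) which respects triangle moves (links of `S` have
exactly 24 edges by `margins`, links of the model 24, so `π` is a link ISOMORPHISM — triage F4);
(ii) the flag 2-complex of the contact graph of `model s` is simply connected (it contains the
2-skeleton of the tetrahedron–octahedron tiling of `ℝ³` by the stacking; octahedron squares bound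
four triangles), so the monodromy construction `φ(b) := end of the lift at q of π(walk p → b)` is a
well-defined deck transformation with `φ p = q` for any two sites of one fibre — fibres are orbits;
(iii) every automorphism of the contact graph of an ideal stacking is the restriction of a unique
isometry (closed stars are rigid: `Aut(cuboctahedron graph) = O_h`, `Aut(J27 graph) = D_3h`, and
adjacent closed stars share a bond plus its 4 common neighbours, affinely spanning); (iv) a deck
transformation fixing a site is the identity (connected cover), and the model spans `ℝ³` affinely,
so `H` acts freely.  No tolerance enters.  Infrastructure not in tree (≈ 1k lines): walks/lifting
for these concrete graphs, combinatorial simple connectivity of the stacking's flag complex.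
Leans on: Mathlib `SimpleGraph.Walk` (optional), `IsometryEquiv`, `AffineIsometryEquiv`
(`IsometryEquiv.toRealAffineIsometryEquiv`), `AffineIndependent`; tree `BarlowStacking`
(`dist_barlowPos_eq_iff`, `ncard_touching_eq_twelve`), `KissingRigidity.{fccTab, hcpTab}`. -/
theorem stub_deckGroup :
    ∀ S : Set E3, EveryPointGood S → ∀ s : ℤ → ℤ, IsHaggSeq s → ∀ π : E3 → E3,
      IsBarlowCover S s π → ∃ H : Subgroup (E3 ≃ᵢ E3), IsDeckGroup s π H := by
  sorry

/-- **Stub 3 (cubic growth; M).** The window graph of a non-empty every-point-good `S` grows at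
least cubically, uniformly in the centre: `c·n³ ≤ #ball_W(S, x, n)` for all `x ∈ S`, `n ≥ 1`.

Why plausible: hard core `dist ≥ 0.891` (`hardCore_bounds`: a point within `5aₓ/4` is a shell
point at `≥ 0.99 aₓ`, anything else is `≥ 1.125` away); covering radius `≤ 0.7215·aₓ < 3/4` (the
largest empty cap of either pattern is the `45°` square-face cap, `+0.6°` for the matching); linear
Euclid-to-graph distortion (greedy: from `z` at distance `≥ 2` of `x` some window-neighbour of `x`
is `≥ 0.35` closer to `z`; `S ∩ B(x, 1.6aₓ) ⊆ N²[x]`), so `ball_W(x, n) ⊇ S ∩ B(x, n/3 − 2)`, which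
holds `≥ c' n³` disjoint covering balls' worth of points; small `n` are absorbed into `c`
(`#ball ≥ 1`).  The ball is finite (contained in `B(x, 1.12 n)`, hard core), so `ncard` counts it.
The every-point hypothesis is used unweakened (the interpenetrating witness of
`shellsToBarlowChart_false_subshell` has no hard core).
Leans on: `KissingPatterns.{one_le_dist_of_mem_fccKissingPattern, …hcp…, card_eq_twelve_of_shellCloseTo}`,
Negative `hardCore_bounds`, `margins`; Mathlib `Set.ncard`, volume of balls
(`EuclideanSpace.volume_ball`) or a lattice-point count. -/
theorem stub_cubicGrowth :
    ∀ S : Set E3, S.Nonempty → EveryPointGood S →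
      ∃ c : ℝ, 0 < c ∧ ∀ x ∈ S, ∀ n : ℕ, 1 ≤ n → c * (n : ℝ) ^ 3 ≤ ((ball W S x n).ncard : ℝ) := by
  sorry

/-- **Stub 4 (finite branch, model side; M).** An isometry of `ℝ³` mapping the ideal stacking into
itself and having finite order moves some site by graph distance `≤ 2`: it fixes it, or maps it to a
contact, or to a contact of a contact.

Why plausible: the finite cyclic group `⟨g⟩` fixes the centroid `c` of any orbit (isometries of
`ℝ³` are affine: Mazur–Ulam); the stacking has covering radius `< 1` (tree
`exists_dist_barlowPos_lt_two` at Hales's scale `2`; sharp value `1/√2`), so the site `p` nearest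
to `c` has `dist (g p) p ≤ 2·dist p c < 2`; and two sites of an ideal stacking at distance `< 2` are
at distance `1, √2, √(8/3), √3` or `√(11/3)`, each realised with a common contact neighbour
(octahedron diagonal; second-layer / in-layer second neighbours — checked by all three triagers).
Leans on: `BarlowStacking.{dist_barlowPos_sq, dist_barlowPos_eq_iff, le_dist_of_mem_barlowStacking}`,
`LayerStackings.exists_dist_barlowPos_lt_two` + Negative `smul_mem_barlowStacking_iff` (rescaling
`2 ↦ 1`), Mathlib `IsometryEquiv.toRealAffineIsometryEquiv`, `Finset.centroid`. -/
theorem stub_shortMove_of_finiteOrder :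
    ∀ s : ℤ → ℤ, IsHaggSeq s → ∀ g : E3 ≃ᵢ E3, (∀ p ∈ model s, g p ∈ model s) →
      ∀ n : ℕ, 1 ≤ n → g ^ n = 1 →
        ∃ p ∈ model s, g p = p ∨ dist p (g p) = 1 ∨
          ∃ r ∈ model s, dist p r = 1 ∧ dist r (g p) = 1 := by
  sorry

/-- **Stub 5 (infinite branch, model side; M).** An isometry of `ℝ³` mapping the ideal stacking
into itself all of whose positive powers are non-trivial has a positive power which is a
translation by a non-zero vector (the point group of a stacking is finite).

Why plausible: write `g x = A x + b` (Mazur–Ulam).  `g` maps contacts to contacts inside the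
stacking, so `A` maps the finite set `V` of bond vectors of `model s` (six in-layer vectors and at
most six "up" and six "down" vectors: `≤ 18`, spanning `ℝ³`) injectively into itself; hence `A`
lies in the finite group of linear isometries permuting `V`, `A^m = 1` for some `m ≥ 1`, and
`g^m` is the translation by `v := g^m 0`; `v ≠ 0` because `g^m ≠ 1`.
Leans on: Mathlib `IsometryEquiv.toRealAffineIsometryEquiv`, `LinearIsometryEquiv`,
`Equiv.Perm` of a `Fintype` has finite order (`isOfFinOrder_of_finite`), tree
`BarlowStacking.dist_barlowPos_eq_iff` (the bond vectors), `BarlowRings` (contact offsets). -/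
theorem stub_translation_of_infiniteOrder :
    ∀ s : ℤ → ℤ, IsHaggSeq s → ∀ g : E3 ≃ᵢ E3, (∀ p ∈ model s, g p ∈ model s) →
      (∀ n : ℕ, 1 ≤ n → g ^ n ≠ 1) →
        ∃ m : ℕ, 1 ≤ m ∧ ∃ v : E3, v ≠ 0 ∧ ∀ x : E3, (g ^ m) x = x + v := by
  sorry

/-- **Stub 6 (quadratic growth modulo a translation, model side; M).** If the ideal stacking is
invariant under the translation by `v ≠ 0`, then the graph `n`-ball of its contact graph meets at
most `K n²` FORWARD `ℤv`-classes: there is a set `F` of `≤ K n²` points such that every site of the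
ball has a translate `q + k v`, `k ∈ ℕ`, in `F` (`K` depends on `s, v` only).

Why plausible: contacts have length `1`, so `ball_C(p₀, n) ⊆ B(p₀, n)`; push each site `q` of the
ball forward along `v` to the first `k ≥ 0` with `⟪q + k v − p₀, v⟫ ≥ n‖v‖`; the pushed points are
sites (invariance), lie in the slab `n‖v‖ ≤ ⟪· − p₀, v⟫ < (n + ‖v‖)‖v‖` of the solid cylinder of
radius `n` about `p₀ + ℝv`, and are `1`-separated (`le_dist_of_mem_barlowStacking`), so by volume
there are `≤ 6 (n + 1/2)² (‖v‖ + 1) ≤ 14 (‖v‖ + 1) n²` of them.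
Leans on: `BarlowStacking.le_dist_of_mem_barlowStacking`, Mathlib `MeasureTheory.Measure.addHaar_ball`
/ `EuclideanSpace.volume_ball`, disjoint-balls volume count (or an explicit lattice-box count via
`barlowPos` coordinates), `Nat.find`. -/
theorem stub_quadraticGrowth_modTranslation :
    ∀ s : ℤ → ℤ, IsHaggSeq s → ∀ v : E3, v ≠ 0 → (∀ p ∈ model s, p + v ∈ model s) →
      ∃ K : ℝ, ∀ p₀ ∈ model s, ∀ n : ℕ, 1 ≤ n → ∃ F : Finset E3,
        (F.card : ℝ) ≤ K * (n : ℝ) ^ 2 ∧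
          ∀ q ∈ ball C (model s) p₀ n, ∃ k : ℕ, q + (k : ℝ) • v ∈ F := by
  sorry

/-! ## Glue (proved): elementary facts about graph balls, lifting, translation invariance -/

/-- Radius `0`. -/
theorem ball_zero (R : E3 → E3 → Prop) (A : Set E3) (x : E3) : ball R A x 0 = {x} := rfl

/-- Radius `n + 1`. -/
theorem ball_succ (R : E3 → E3 → Prop) (A : Set E3) (x : E3) (n : ℕ) :
    ball R A x (n + 1) = ball R A x n ∪ {z : E3 | z ∈ A ∧ ∃ y ∈ ball R A x n, R y z} := rfl

/-- Balls increase with the radius. -/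
theorem ball_mono (R : E3 → E3 → Prop) (A : Set E3) (x : E3) (n : ℕ) :
    ball R A x n ⊆ ball R A x (n + 1) := by
  rw [ball_succ]; exact Set.subset_union_left

/-- Balls about a point of `A` stay inside `A`. -/
theorem ball_subset {R : E3 → E3 → Prop} {A : Set E3} {x : E3} (hx : x ∈ A) :
    ∀ n : ℕ, ball R A x n ⊆ A
  | 0 => by
      rw [ball_zero]
      exact Set.singleton_subset_iff.2 hx
  | n + 1 => by
      rw [ball_succ]
      exact Set.union_subset (ball_subset hx n) fun z hz => hz.1

/-- One more step. -/
theorem mem_ball_succ_of_rel {R : E3 → E3 → Prop} {A : Set E3} {x y z : E3} {n : ℕ}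
    (hy : y ∈ ball R A x n) (hz : z ∈ A) (h : R y z) : z ∈ ball R A x (n + 1) := by
  rw [ball_succ]
  exact Or.inr ⟨hz, y, hy, h⟩

/-- **Walk lifting.** Under a star-bijective Barlow cover, the window-graph `n`-ball about `π p₀`
is covered by the image of the contact-graph `n`-ball about `p₀`. -/
theorem ball_window_subset_image {S : Set E3} {s : ℤ → ℤ} {π : E3 → E3}
    (hπ : IsBarlowCover S s π) {p₀ : E3} (hp₀ : p₀ ∈ model s) :
    ∀ n : ℕ, ball W S (π p₀) n ⊆ π '' ball C (model s) p₀ n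
  | 0 => by
      intro z hz
      rw [ball_zero, Set.mem_singleton_iff] at hz
      refine ⟨p₀, ?_, hz.symm⟩
      rw [ball_zero]
      exact Set.mem_singleton _
  | n + 1 => by
      intro z hz
      rw [ball_succ] at hz
      rcases hz with hz | ⟨hzS, y, hy, hyz⟩
      · obtain ⟨q, hq, rfl⟩ := ball_window_subset_image hπ hp₀ n hz
        exact ⟨q, ball_mono _ _ _ _ hq, rfl⟩
      · obtain ⟨p, hp, rfl⟩ := ball_window_subset_image hπ hp₀ n hy
        have hpB : p ∈ model s := ball_subset hp₀ n hp
        obtain ⟨q, ⟨hqB, hpq⟩, rfl⟩ := (hπ.2.2 p hpB).surjOn ⟨hzS, hyz⟩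
        exact ⟨q, mem_ball_succ_of_rel hp hqB hpq, rfl⟩

/-- **Translation invariance of the fibres.** If the deck group contains the translation by `v`,
then `π (q + k v) = π q` for every site `q` and `k ∈ ℕ`. -/
theorem apply_add_nsmul {s : ℤ → ℤ} {π : E3 → E3} {H : Subgroup (E3 ≃ᵢ E3)}
    (hH : IsDeckGroup s π H) {t : E3 ≃ᵢ E3} (ht : t ∈ H) {v : E3} (htv : ∀ x : E3, t x = x + v) :
    ∀ k : ℕ, ∀ q ∈ model s, q + (k : ℝ) • v ∈ model s ∧ π (q + (k : ℝ) • v) = π q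
  | 0 => fun q hq => by simpa using hq
  | k + 1 => fun q hq => by
      obtain ⟨hk, hπk⟩ := apply_add_nsmul hH ht htv k q hq
      have hstep : q + ((k + 1 : ℕ) : ℝ) • v = (q + (k : ℝ) • v) + v := by
        push_cast
        rw [add_smul, one_smul, add_assoc]
      have hmem : (q + (k : ℝ) • v) + v ∈ model s := by
        rw [← htv]
        exact hH.1 t ht _ hk
      refine ⟨by rw [hstep]; exact hmem, ?_⟩
      rw [hstep, ← hπk]
      exact ((hH.2.2 _ hk _ hmem).2 ⟨t, ht, htv _⟩).symm

/-! ## The composition: the six stubs imply the crux, BY NAME -/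

/-- **`ShellsToBarlowChart` from the six stubs.**  Proof: cover `π : model s → S` (stub 1) with
deck group `H` (stub 2).  If some `g ∈ H` is non-trivial: finite order is excluded by stub 4
(a site moved by graph distance `≤ 2` inside one fibre contradicts freeness / the bond clause /
star-injectivity), infinite order gives a translation `t = g^m ∈ H` by `v ≠ 0` (stub 5), the
window ball about `π p₀` lifts into the contact ball about `p₀` (walk lifting) on which `π` is
constant along forward `ℤv`-classes, so `#ball_W ≤ K n²` (stub 6) against `c n³ ≤ #ball_W`
(stub 3) — absurd for `n > K/c`.  Hence `H = 1`, `π` is injective on the model, and `Φ := π` is the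
bond-isomorphism (`dist = 1 ↔ window` from the bond clause, star-surjectivity and injectivity). -/
theorem ShellsToBarlowChart_of (hCover : Registered.stub_barlowCover)
    (hDeck : Registered.stub_deckGroup) (hCubic : Registered.stub_cubicGrowth)
    (hFin : Registered.stub_shortMove_of_finiteOrder)
    (hInf : Registered.stub_translation_of_infiniteOrder)
    (hQuad : Registered.stub_quadraticGrowth_modTranslation) :
    Summit.AtomisticToContinuum.Crystallization.Theses.PalmUnimodularRigidity.ShellsToBarlowChart := by
  intro S hne hgood
  have hgood' : EveryPointGood S := hgood
  obtain ⟨s, hs, π, hπ⟩ := hCover S hne hgood'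
  obtain ⟨H, hH⟩ := hDeck S hgood' s hs π hπ
  obtain ⟨hmaps, hsurj, hstar⟩ := hπ
  obtain ⟨hpres, hfree, hfib⟩ := hH
  -- Step 1: the deck group is trivial (the dichotomy).
  have htriv : ∀ g ∈ H, g = 1 := by
    by_contra hnon
    push Not at hnon
    obtain ⟨g, hgH, hg1⟩ := hnon
    have hgB : ∀ p ∈ model s, g p ∈ model s := hpres g hgH
    have hsame : ∀ p ∈ model s, π (g p) = π p := fun p hp =>
      ((hfib p hp (g p) (hgB p hp)).2 ⟨g, hgH, rfl⟩).symm
    by_cases hfin : ∃ n : ℕ, 1 ≤ n ∧ g ^ n = 1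
    · -- FINITE branch: a site moved by graph distance ≤ 2 inside its own fibre.
      obtain ⟨n, hn, hgn⟩ := hfin
      obtain ⟨p, hp, hmove⟩ := hFin s hs g hgB n hn hgn
      have hgp : g p ∈ model s := hgB p hp
      rcases hmove with h0 | h1 | ⟨r, hr, hpr, hrg⟩
      · exact hg1 (hfree g hgH p hp h0)
      · obtain ⟨hpos, -⟩ := ((hstar p hp).mapsTo ⟨hgp, h1⟩).2
        rw [hsame p hp, dist_self] at hpos
        exact lt_irrefl _ hpos
      · have hrp : dist r p = 1 := by rw [dist_comm]; exact hpr
        have hpg : p = g p :=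
          (hstar r hr).injOn ⟨hp, hrp⟩ ⟨hgp, hrg⟩ (hsame p hp).symm
        exact hg1 (hfree g hgH p hp hpg.symm)
    · -- INFINITE branch: a translation in `H`, quadratic versus cubic growth.
      push Not at hfin
      obtain ⟨m, -, v, hv, hgm⟩ := hInf s hs g hgB (fun n hn => hfin n hn)
      have hgmH : g ^ m ∈ H := H.pow_mem hgH m
      have hBv : ∀ p ∈ model s, p + v ∈ model s := fun p hp => by
        rw [← hgm p]
        exact hpres _ hgmH p hp
      obtain ⟨K, hK⟩ := hQuad s hs v hv hBv
      obtain ⟨c, hc, hcub⟩ := hCubic S hne hgood'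
      obtain ⟨p₀, hp₀⟩ : ∃ p : E3, p ∈ model s :=
        ⟨barlowPos 1 (Real.sqrt (2 / 3)) s 0 0 0, barlowPos_mem 0 0 0⟩
      have hx₀ : π p₀ ∈ S := hmaps hp₀
      obtain ⟨N, hN⟩ := exists_nat_gt (K / c)
      have hn1 : 1 ≤ N + 1 := Nat.le_add_left 1 N
      obtain ⟨F, hFcard, hFcov⟩ := hK p₀ hp₀ (N + 1) hn1
      have hlow := hcub (π p₀) hx₀ (N + 1) hn1
      -- the window ball is covered by `π '' F`
      have hsub : ball W S (π p₀) (N + 1) ⊆ π '' (↑F : Set E3) := by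
        intro z hz
        obtain ⟨q, hq, rfl⟩ :=
          ball_window_subset_image ⟨hmaps, hsurj, hstar⟩ hp₀ (N + 1) hz
        have hqB : q ∈ model s := ball_subset hp₀ _ hq
        obtain ⟨k, hk⟩ := hFcov q hq
        obtain ⟨-, hπk⟩ := apply_add_nsmul ⟨hpres, hfree, hfib⟩ hgmH hgm k q hqB
        exact ⟨q + (k : ℝ) • v, hk, hπk⟩
      have hfinite : (π '' (↑F : Set E3)).Finite := F.finite_toSet.image π
      have hup : ((ball W S (π p₀) (N + 1)).ncard : ℝ) ≤ K * ((N + 1 : ℕ) : ℝ) ^ 2 := by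
        have h1 : (ball W S (π p₀) (N + 1)).ncard ≤ (π '' (↑F : Set E3)).ncard :=
          Set.ncard_le_ncard hsub hfinite
        have h2 : (π '' (↑F : Set E3)).ncard ≤ F.card :=
          calc (π '' (↑F : Set E3)).ncard ≤ (↑F : Set E3).ncard :=
                Set.ncard_image_le F.finite_toSet
            _ = F.card := Set.ncard_coe_finset F
        calc ((ball W S (π p₀) (N + 1)).ncard : ℝ) ≤ (F.card : ℝ) := by
              exact_mod_cast h1.trans h2
          _ ≤ K * ((N + 1 : ℕ) : ℝ) ^ 2 := hFcard
      have hle : c * ((N + 1 : ℕ) : ℝ) ^ 3 ≤ K * ((N + 1 : ℕ) : ℝ) ^ 2 := hlow.trans hup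
      have hcn : c * ((N + 1 : ℕ) : ℝ) ≤ K := by
        have hmul : c * ((N + 1 : ℕ) : ℝ) * ((N + 1 : ℕ) : ℝ) ^ 2 ≤ K * ((N + 1 : ℕ) : ℝ) ^ 2 :=
          calc c * ((N + 1 : ℕ) : ℝ) * ((N + 1 : ℕ) : ℝ) ^ 2 = c * ((N + 1 : ℕ) : ℝ) ^ 3 := by
                ring
            _ ≤ K * ((N + 1 : ℕ) : ℝ) ^ 2 := hle
        exact le_of_mul_le_mul_right hmul (by positivity)
      have hNle : ((N + 1 : ℕ) : ℝ) ≤ K / c := by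
        rw [le_div_iff₀ hc]
        linarith
      have hNN : (N : ℝ) < N :=
        calc (N : ℝ) < ((N + 1 : ℕ) : ℝ) := by push_cast; linarith
          _ ≤ K / c := hNle
          _ < N := hN
      exact lt_irrefl _ hNN
  -- Step 2: `π` is injective on the model, hence the chart.
  have hinj : Set.InjOn π (model s) := by
    intro p hp q hq hpq
    obtain ⟨g, hgH, hgpq⟩ := (hfib p hp q hq).1 hpq
    rw [htriv g hgH] at hgpq
    simpa using hgpq
  refine ⟨s, hs, π, ⟨hmaps, hinj, hsurj⟩, ?_⟩
  intro p hp q hq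
  constructor
  · intro hpq
    exact ((hstar p hp).mapsTo ⟨hq, hpq⟩).2
  · intro hw
    obtain ⟨q', ⟨hq'B, hpq'⟩, hq'q⟩ := (hstar p hp).surjOn ⟨hmaps hq, hw⟩
    rw [← hinj hq'B hq hq'q]
    exact hpq'

/-! ## Consistency: each named statement IS its registered stub (definitionally) -/

theorem registered_barlowCover_holds : Registered.stub_barlowCover := stub_barlowCover
theorem registered_deckGroup_holds : Registered.stub_deckGroup := stub_deckGroup
theorem registered_cubicGrowth_holds : Registered.stub_cubicGrowth := stub_cubicGrowth
theorem registered_shortMove_of_finiteOrder_holds : Registered.stub_shortMove_of_finiteOrder :=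
  stub_shortMove_of_finiteOrder
theorem registered_translation_of_infiniteOrder_holds :
    Registered.stub_translation_of_infiniteOrder := stub_translation_of_infiniteOrder
theorem registered_quadraticGrowth_modTranslation_holds :
    Registered.stub_quadraticGrowth_modTranslation := stub_quadraticGrowth_modTranslation

/-- Certificate that the six registered stubs prove the six named statements `Registered.stub_*`
DEFINITIONALLY, i.e. that the hypotheses of `ShellsToBarlowChart_of` are exactly the registered stub
signatures (an `example`, so nothing sorried enters the environment under a new name). -/
example : Summit.AtomisticToContinuum.Crystallization.Theses.PalmUnimodularRigidity.ShellsToBarlowChart :=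
  ShellsToBarlowChart_of stub_barlowCover stub_deckGroup stub_cubicGrowth stub_shortMove_of_finiteOrder
    stub_translation_of_infiniteOrder stub_quadraticGrowth_modTranslation

end Summit.AtomisticToContinuum.Crystallization.Cruxes.ShellsToBarlowChart.HolonomyGrowthDichotomy
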